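import Literature.Probability.LatticeModels.LatticeGreenFiveSevenCertificate
import HarnessLib

/-!
# The infrared constant `R(6)` of Salmhofer–Seiler, kernel-certified (`R(6) ≤ 0.1862`), and a
# sharper enclosure of `R(5)` (CMP 139 (1991), Prop. 4.2 (4), p. 430)

Companion of `LatticeGreenFourCertificate` / `LatticeGreenFiveSevenCertificate`: the same certificate
(`dR(d) = Σ_{n<K} P(Sₙ = 0) + Rem_K`, `LatticeGreenReturnSeries`; exact rational return
probabilities; `r(u) ≤ c u^{-1/2}` tails) for the six-dimensional value of the printed table
"`R(6) ≤ 0.1862`" (p. 430), and the five-dimensional value pushed from `K = 42` to `K = 105` terms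
(`5R(5) ≤ 1.1568` instead of `≤ 1.1816`).  These are the inputs of the kernel certificates for the
`S`-column of Prop. 4.2 (4) in `ν = 5, 6` (`ComplexSpinFluctuationFiveSixCertificate`), i.e. of
Cor. 4.9 for `U(5)` in `ν = 5, 6` dimensions.

* `probSixQ n` — `P(Sₙ = 0)` on `ℤ⁶` as a computable rational: peel `ℤ⁶ = ℤ² × ℤ⁴`,
  `6⁻ⁿ Σ_m binom(n,m) k₂(n-m) F₄(m)` with the two-coordinate moments `k₂` and the four-dimensional
  sums `F₄` of the companion files; `prob_six_eq_probSixQ` (two peelings `setIntegral_sum_cos_pow_succ`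
  regrouped by `sum_sum_choose_cosMomentQ_eq`).
* `srwHeatKernel_zero_le_of_fourteen_le` — `r(u) ≤ 0.43 u^{-1/2}` already for `u ≥ 14` (keeping the
  factor `(π-1)/π ≤ 0.69` that `LatticeGreenFourCertificate.srwHeatKernel_zero_le_of_le` (`u ≥ 21`)
  discards); tails `∫_{14}^∞ r⁶ ≤ 0.43⁶/196`, `∫_{21}^∞ r⁵ ≤ 0.000153`.
* `probSixPartialQ_84_le` / `le_probSixPartialQ_84` (`1.1169009 ≤ Σ_{n<84} ≤ 1.1169010`),
  `probFivePartialQ_105_le` (`Σ_{n<105} ≤ 1.1559606`), by `decide` (≈ 15 s + 25 s of kernel time).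
* **`six_mul_latticeGreen_six_zero_le : 6·latticeGreen 0 ≤ 1.1171`**, `le_six_mul_latticeGreen_six_zero`
  (`1.1168 ≤`), **`latticeGreen_six_zero_le : latticeGreen (0 : Site 6) ≤ 0.1862`** (the printed value;
  true `0.18616`); **`five_mul_latticeGreen_five_zero_le' : 5·latticeGreen 0 ≤ 1.1568`** (true `1.15631`).

## References

* M. Salmhofer, E. Seiler, Commun. Math. Phys. 139 (1991) 395–432, Prop. 4.2 (4), Appendix (A.7),
  Lemma A.4 and p. 430. [SalmhoferSeiler1991]
* A. J. Guttmann, J. Phys. A 43 (2010) 305205, §2.2 (return-probability generating functions of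
  `ℤ^d`). [Guttmann2010]
-/

noncomputable section

open MeasureTheory Set Filter Real Finset

open scoped BigOperators

namespace Literature.Probability.LatticeModels

variable {d : ℕ}

/-! ### Computable rational data -/

/-- **`P(Sₙ = 0)` on `ℤ⁶` as a computable rational**: `6⁻ⁿ Σ_m binom(n,m) k₂(n-m) F₄(m)` (peel two
coordinates off `ℤ⁶ = ℤ² × ℤ⁴`). [cite: Guttmann2010, §2.2] -/
def probSixQ (n : ℕ) : ℚ :=
  sumBelow (fun m => binomQ n m * twoCoordMomentQ (n - m) * fourSumQ m) (n + 1) / (6 : ℚ) ^ n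

/-- Partial sums `Σ_{n<K} P(Sₙ = 0)` on `ℤ⁶`. [cite: Guttmann2010, §2.2] -/
def probSixPartialQ (K : ℕ) : ℚ := sumBelow probSixQ K

/-- `sumBelow f n = Σ_{i ∈ range n} f i`. [folklore] -/
private theorem sumBelow_eq_sum_range'' (f : ℕ → ℚ) : ∀ n, sumBelow f n = ∑ i ∈ Finset.range n, f i
  | 0 => by simp [sumBelow]
  | (n + 1) => by rw [sumBelow, sumBelow_eq_sum_range'' f n, Finset.sum_range_succ]

/-- `binomQ n a = binom(n,a)` for `a ≤ n`. [folklore] -/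
private theorem binomQ_eq_choose'' {n a : ℕ} (h : a ≤ n) : binomQ n a = (n.choose a : ℚ) := by
  unfold binomQ
  have hfac : ((Nat.factorial a * Nat.factorial (n - a) : ℕ) : ℚ) ≠ 0 := by positivity
  rw [div_eq_iff hfac]
  have := Nat.choose_mul_factorial_mul_factorial h
  rw [← this]
  push_cast
  ring

/-- `Σ_{n<84} P(Sₙ = 0) ≤ 1.1169010` on `ℤ⁶` (kernel evaluation). [cite: SalmhoferSeiler1991, p. 430 (`R(6) ≤ 0.1862`)] -/
theorem probSixPartialQ_84_le : probSixPartialQ 84 ≤ 11169010 / 10000000 := by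
  decide +kernel

/-- `1.1169009 ≤ Σ_{n<84} P(Sₙ = 0)` on `ℤ⁶` (kernel evaluation). [cite: SalmhoferSeiler1991, p. 430 (`R(6) ≤ 0.1862`)] -/
theorem le_probSixPartialQ_84 : 11169009 / 10000000 ≤ probSixPartialQ 84 := by
  decide +kernel

/-- `Σ_{n<105} P(Sₙ = 0) ≤ 1.1559606` on `ℤ⁵` (kernel evaluation; the companion file stops at
`K = 42`). [cite: SalmhoferSeiler1991, p. 430 (`R(5) ≤ 0.2313`)] -/
theorem probFivePartialQ_105_le : probFivePartialQ 105 ≤ 11559606 / 10000000 := by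
  decide +kernel

/-! ### The return probabilities on `ℤ⁶` in closed form -/

/-- `∫_{[-π,π]⁴} (Σⱼ cos zⱼ)^m dz = (2π)⁴ F₄(m)`. [cite: Guttmann2010, §2.2] -/
private theorem setIntegral_sum_cos_pow_four' (m : ℕ) :
    ∫ z in brillouin 4, (∑ j, Real.cos (z j)) ^ m = (2 * π) ^ 4 * (fourSumQ m : ℝ) := by
  have h1 := SRW.prob_eq_integral (d := 4) (by norm_num) m
  rw [prob_four_eq_probFourQ] at h1
  have hpow : ∀ θ : Fin 4 → ℝ, (((4 : ℕ) : ℝ)⁻¹ * ∑ j, Real.cos (θ j)) ^ m =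
      ((4 : ℝ) ^ m)⁻¹ * (∑ j, Real.cos (θ j)) ^ m := fun θ => by
    rw [mul_pow, Nat.cast_ofNat, inv_pow]
  simp_rw [hpow] at h1
  rw [integral_const_mul] at h1
  have hF : (fourSumQ m : ℚ) = (4 : ℚ) ^ m * probFourQ m := by
    unfold probFourQ fourSumQ
    rw [mul_div_cancel₀ _ (pow_ne_zero m (by norm_num))]
  have h2π : (2 * π : ℝ) ^ 4 ≠ 0 := by positivity
  have h4 : (4 : ℝ) ^ m ≠ 0 := by positivity
  have hI : ∫ z in brillouin 4, (∑ j, Real.cos (z j)) ^ m =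
      (2 * π) ^ 4 * (4 : ℝ) ^ m * (probFourQ m : ℝ) := by
    rw [h1]
    field_simp
  rw [hI, hF]
  push_cast
  ring

/-- **`P(Sₙ = 0)` on `ℤ⁶` in closed form**: `SRW.prob 6 n 0 = probSixQ n` (peel `ℤ⁶ = ℤ × ℤ × ℤ⁴` and
regroup the two peelings into the two-coordinate moment `k₂`). [cite: Guttmann2010, §2.2] -/
theorem prob_six_eq_probSixQ (n : ℕ) : SRW.prob 6 n 0 = (probSixQ n : ℝ) := by
  rw [SRW.prob_eq_integral (by norm_num) n]
  have hpow : ∀ θ : Fin 6 → ℝ, (((6 : ℕ) : ℝ)⁻¹ * ∑ j, Real.cos (θ j)) ^ n =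
      ((6 : ℝ) ^ n)⁻¹ * (∑ j, Real.cos (θ j)) ^ n := fun θ => by
    rw [mul_pow, Nat.cast_ofNat, inv_pow]
  simp_rw [hpow]
  rw [integral_const_mul, setIntegral_sum_cos_pow_succ (d := 5) n]
  simp_rw [setIntegral_sum_cos_pow_succ (d := 4), setIntegral_sum_cos_pow_four']
  -- regroup the two peelings
  have hre : ∀ m₁ ∈ Finset.range (n + 1), (n.choose m₁ : ℝ) * ((2 * π * (cosMomentQ (n - m₁) : ℝ)) *
      ∑ m ∈ Finset.range (m₁ + 1), (m₁.choose m : ℝ) * ((2 * π * (cosMomentQ (m₁ - m) : ℝ)) *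
        ((2 * π) ^ 4 * (fourSumQ m : ℝ)))) =
      (2 * π) ^ 6 * ((n.choose m₁ : ℝ) * ((cosMomentQ (n - m₁) : ℝ) *
        ∑ m ∈ Finset.range (m₁ + 1), (m₁.choose m : ℝ) * ((cosMomentQ (m₁ - m) : ℝ) *
          (fourSumQ m : ℝ)))) := by
    intro m₁ _
    simp only [Finset.mul_sum]
    refine Finset.sum_congr rfl fun m _ => ?_
    ring
  rw [Finset.sum_congr rfl hre, ← Finset.mul_sum,
    sum_sum_choose_cosMomentQ_eq n (fun m => (fourSumQ m : ℝ))]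
  unfold probSixQ
  rw [sumBelow_eq_sum_range'']
  push_cast
  simp only [Finset.sum_div, Finset.mul_sum]
  refine Finset.sum_congr rfl fun m hm => ?_
  rw [binomQ_eq_choose'' (Nat.lt_succ_iff.1 (Finset.mem_range.1 hm))]
  push_cast
  have h2π : (2 * π : ℝ) ≠ 0 := by positivity
  have h6 : (6 : ℝ) ^ n ≠ 0 := by positivity
  field_simp

/-- `Σ_{n<K} P(Sₙ = 0) = probSixPartialQ K` on `ℤ⁶`. [cite: Guttmann2010, §2.2] -/
theorem sum_range_prob_six_eq (K : ℕ) :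
    ∑ n ∈ Finset.range K, SRW.prob 6 n 0 = (probSixPartialQ K : ℝ) := by
  unfold probSixPartialQ
  rw [sumBelow_eq_sum_range'']
  push_cast
  exact Finset.sum_congr rfl fun n _ => prob_six_eq_probSixQ n

/-! ### `r(u) ≤ 0.43 u^{-1/2}` already for `u ≥ 14`, and the tails of (A.7) -/

/-- `e^{-4u/9} √u ≤ e^{-6} √14` for `u ≥ 14` (`√(u/14) ≤ 1 + 4(u-14)/9 ≤ e^{4(u-14)/9}`,
`e^{-56/9} ≤ e^{-6}`). [folklore] -/
private theorem exp_neg_mul_sqrt_le_fourteen {u : ℝ} (hu : 14 ≤ u) :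
    Real.exp (-(4 / 9 * u)) * Real.sqrt u ≤ Real.exp (-6) * Real.sqrt 14 := by
  set v : ℝ := 4 / 9 * (u - 14) with hv
  have hv0 : 0 ≤ v := by rw [hv]; linarith
  have h1 : Real.sqrt u ≤ Real.sqrt 14 * (1 + v) := by
    have h14 : Real.sqrt 14 * (1 + v) = Real.sqrt (14 * (1 + v) ^ 2) := by
      rw [Real.sqrt_mul (by norm_num), Real.sqrt_sq (by linarith)]
    rw [h14]
    exact Real.sqrt_le_sqrt (by rw [hv]; nlinarith)
  have h2 : 1 + v ≤ Real.exp v := by linarith [Real.add_one_le_exp v]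
  have h3 : Real.sqrt u ≤ Real.sqrt 14 * Real.exp v :=
    h1.trans (mul_le_mul_of_nonneg_left h2 (Real.sqrt_nonneg _))
  have h4 : Real.exp (-(4 / 9 * u)) * Real.exp v ≤ Real.exp (-6) := by
    rw [← Real.exp_add]
    exact Real.exp_le_exp.2 (by rw [hv]; linarith)
  calc Real.exp (-(4 / 9 * u)) * Real.sqrt u
      ≤ Real.exp (-(4 / 9 * u)) * (Real.sqrt 14 * Real.exp v) :=
        mul_le_mul_of_nonneg_left h3 (Real.exp_pos _).le
    _ = Real.exp (-(4 / 9 * u)) * Real.exp v * Real.sqrt 14 := by ring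
    _ ≤ Real.exp (-6) * Real.sqrt 14 :=
        mul_le_mul_of_nonneg_right h4 (Real.sqrt_nonneg _)

/-- `e^{-6} √14 ≤ 0.0093` (`e^{-1} < 0.3678794412`, `√14 ≤ 3.7417`). [folklore] -/
private theorem exp_neg_six_mul_sqrt_le : Real.exp (-6) * Real.sqrt 14 ≤ 93 / 10000 := by
  have he : Real.exp (-6) = Real.exp (-1) ^ 6 := by
    rw [← Real.exp_nat_mul]; norm_num
  have he1 : Real.exp (-1) ^ 6 ≤ (0.3678794412 : ℝ) ^ 6 :=
    pow_le_pow_left₀ (Real.exp_pos _).le Real.exp_neg_one_lt_d9.le 6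
  have hs : Real.sqrt 14 ≤ 3.7417 := by
    rw [Real.sqrt_le_left (by norm_num)]
    norm_num
  rw [he]
  calc Real.exp (-1) ^ 6 * Real.sqrt 14 ≤ (0.3678794412 : ℝ) ^ 6 * 3.7417 :=
        mul_le_mul he1 hs (Real.sqrt_nonneg _) (by positivity)
    _ ≤ 93 / 10000 := by norm_num

/-- **`r(u) ≤ 0.43 u^{-1/2}` for `u ≥ 14`** (from `srwHeatKernel_zero_le_sharp`: the Gaussian term is
`≤ 0.4225 u^{-1/2}`, the exponential one `≤ 0.69 · 0.0093 u^{-1/2}`).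
[cite: SalmhoferSeiler1991, Lemma A.4 (A.22)] -/
theorem srwHeatKernel_zero_le_of_fourteen_le {u : ℝ} (hu : 14 ≤ u) :
    srwHeatKernel u 0 ≤ 43 / 100 / Real.sqrt u := by
  have hu0 : 0 < u := by linarith
  have hsu : 0 < Real.sqrt u := Real.sqrt_pos.2 hu0
  have h := srwHeatKernel_zero_le_sharp hu0
  -- the Gaussian term
  have hA : Real.sqrt (π / (43 / 96 * u)) / (2 * π) ≤ 4225 / 10000 / Real.sqrt u := by
    rw [div_le_div_iff₀ (by positivity) hsu]
    have hmul : Real.sqrt (π / (43 / 96 * u)) * Real.sqrt u = Real.sqrt (π / (43 / 96)) := by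
      rw [← Real.sqrt_mul (by positivity)]
      congr 1
      field_simp
    rw [hmul, Real.sqrt_le_left (by positivity)]
    nlinarith [Real.pi_gt_d2, Real.pi_pos]
  -- the exponentially small term, keeping `(π - 1)/π ≤ 0.69`
  have hB : (π - 1) / π * Real.exp (-(4 / 9 * u)) ≤ 69 / 100 * (93 / 10000) / Real.sqrt u := by
    have hfrac : (π - 1) / π ≤ 69 / 100 := by
      rw [div_le_iff₀ Real.pi_pos]
      linarith [Real.pi_lt_d2]
    have hfrac0 : 0 ≤ (π - 1) / π := div_nonneg (by linarith [Real.pi_gt_three]) Real.pi_pos.le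
    have hkey : Real.exp (-(4 / 9 * u)) ≤ 93 / 10000 / Real.sqrt u := by
      rw [le_div_iff₀ hsu]
      exact (exp_neg_mul_sqrt_le_fourteen hu).trans exp_neg_six_mul_sqrt_le
    calc (π - 1) / π * Real.exp (-(4 / 9 * u)) ≤ 69 / 100 * (93 / 10000 / Real.sqrt u) :=
          mul_le_mul hfrac hkey (Real.exp_pos _).le (by norm_num)
      _ = 69 / 100 * (93 / 10000) / Real.sqrt u := by ring
  calc srwHeatKernel u 0 ≤ _ := h
    _ ≤ 4225 / 10000 / Real.sqrt u + 69 / 100 * (93 / 10000) / Real.sqrt u := add_le_add hA hB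
    _ ≤ 43 / 100 / Real.sqrt u := by
        rw [← add_div]
        exact div_le_div_of_nonneg_right (by norm_num) hsu.le

/-- `r(u)⁶ ≤ 0.43⁶ (u²)⁻¹ 14⁻¹` for `u ≥ 14`. [cite: SalmhoferSeiler1991, Lemma A.4 (A.22)] -/
private theorem srwHeatKernel_zero_pow_six_le {u : ℝ} (hu : 14 ≤ u) :
    srwHeatKernel u 0 ^ 6 ≤ (43 / 100) ^ 6 * ((u ^ 2)⁻¹ * (14 : ℝ)⁻¹) := by
  have hu0 : 0 < u := by linarith
  have h := pow_le_pow_left₀ (srwHeatKernel_zero_nonneg u) (srwHeatKernel_zero_le_of_fourteen_le hu) 6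
  have hsq : Real.sqrt u ^ 6 = u ^ 3 := by
    rw [show (6 : ℕ) = 2 * 3 from rfl, pow_mul, Real.sq_sqrt hu0.le]
  rw [div_pow, hsq] at h
  refine h.trans ?_
  rw [div_eq_mul_inv]
  refine mul_le_mul_of_nonneg_left ?_ (by positivity)
  rw [← mul_inv, show u ^ 3 = u ^ 2 * u by ring]
  exact (inv_le_inv₀ (by positivity) (by positivity)).2 (by nlinarith)

/-- `r(u)⁵ ≤ 0.43⁵ (u²)⁻¹ (√21)⁻¹` for `u ≥ 21`. [cite: SalmhoferSeiler1991, Lemma A.4 (A.22)] -/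
private theorem srwHeatKernel_zero_pow_five_le' {u : ℝ} (hu : 21 ≤ u) :
    srwHeatKernel u 0 ^ 5 ≤ (43 / 100) ^ 5 * ((u ^ 2)⁻¹ * (Real.sqrt 21)⁻¹) := by
  have hu0 : 0 < u := by linarith
  have hsu : 0 < Real.sqrt u := Real.sqrt_pos.2 hu0
  have hsc : 0 < Real.sqrt 21 := Real.sqrt_pos.2 (by norm_num)
  have h := pow_le_pow_left₀ (srwHeatKernel_zero_nonneg u) (srwHeatKernel_zero_le_of_le hu) 5
  rw [div_pow] at h
  refine h.trans ?_
  rw [div_eq_mul_inv]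
  refine mul_le_mul_of_nonneg_left ?_ (by positivity)
  have hsq : Real.sqrt u ^ 5 = u ^ 2 * Real.sqrt u := by
    rw [show (5 : ℕ) = 2 * 2 + 1 from rfl, pow_succ, pow_mul, Real.sq_sqrt hu0.le]
  rw [hsq, mul_inv]
  exact mul_le_mul_of_nonneg_left ((inv_le_inv₀ hsu hsc).2 (Real.sqrt_le_sqrt hu)) (by positivity)

/-- `∫_c^∞ (u²)⁻¹ du = c⁻¹` with integrability (`c > 0`). [folklore] -/
private theorem integral_Ioi_inv_sq'' {c : ℝ} (hc : 0 < c) :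
    IntegrableOn (fun u : ℝ => (u ^ 2)⁻¹) (Ioi c) ∧ ∫ u in Ioi c, (u ^ 2)⁻¹ = c⁻¹ := by
  have hcongr : ∀ u ∈ Ioi c, (u : ℝ) ^ (-2 : ℝ) = (u ^ 2)⁻¹ := fun u hu => by
    rw [Real.rpow_neg (le_of_lt (hc.trans hu)), Real.rpow_two]
  have hint := integrableOn_Ioi_rpow_of_lt (by norm_num : (-2 : ℝ) < -1) hc
  have hval := integral_Ioi_rpow_of_lt (by norm_num : (-2 : ℝ) < -1) hc
  refine ⟨(integrableOn_congr_fun hcongr measurableSet_Ioi).1 hint, ?_⟩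
  rw [← setIntegral_congr_fun measurableSet_Ioi hcongr, hval]
  rw [show (-2 : ℝ) + 1 = -1 by norm_num, Real.rpow_neg_one]
  ring

/-- **The tail of (A.7) in `ν = 6` beyond `u = 14`**: `∫_{14}^∞ r⁶ ≤ 0.43⁶/196`.
[cite: SalmhoferSeiler1991, Appendix (A.7), Lemma A.4] -/
theorem integral_Ioi_srwHeatKernel_zero_pow_six_le :
    ∫ u in Ioi (14 : ℝ), srwHeatKernel u 0 ^ 6 ≤ (43 / 100) ^ 6 / 196 := by
  have hc : (0 : ℝ) < 14 := by norm_num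
  obtain ⟨hint, -⟩ := setIntegral_exp_mul_inv_dispersion_eq (d := 6) (by norm_num) hc.le
  obtain ⟨hmaj0, hval0⟩ := integral_Ioi_inv_sq'' hc
  have hmaj := hmaj0.const_mul ((43 / 100 : ℝ) ^ 6 * (14 : ℝ)⁻¹)
  have hle : ∫ u in Ioi (14 : ℝ), srwHeatKernel u 0 ^ 6 ≤
      ∫ u in Ioi (14 : ℝ), (43 / 100 : ℝ) ^ 6 * (14 : ℝ)⁻¹ * (u ^ 2)⁻¹ := by
    refine setIntegral_mono_on hint hmaj measurableSet_Ioi fun u hu => ?_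
    have h := srwHeatKernel_zero_pow_six_le (le_of_lt hu)
    calc srwHeatKernel u 0 ^ 6 ≤ (43 / 100) ^ 6 * ((u ^ 2)⁻¹ * (14 : ℝ)⁻¹) := h
      _ = (43 / 100 : ℝ) ^ 6 * (14 : ℝ)⁻¹ * (u ^ 2)⁻¹ := by ring
  rw [integral_const_mul, hval0] at hle
  refine hle.trans (le_of_eq ?_)
  norm_num

/-- **The tail of (A.7) in `ν = 5` beyond `u = 21`**: `∫_{21}^∞ r⁵ ≤ 0.43⁵/(21√21) ≤ 0.000153`.
[cite: SalmhoferSeiler1991, Appendix (A.7), Lemma A.4] -/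
theorem integral_Ioi_srwHeatKernel_zero_pow_five_le' :
    ∫ u in Ioi (21 : ℝ), srwHeatKernel u 0 ^ 5 ≤ 153 / 1000000 := by
  have hc : (0 : ℝ) < 21 := by norm_num
  obtain ⟨hint, -⟩ := setIntegral_exp_mul_inv_dispersion_eq (d := 5) (by norm_num) hc.le
  obtain ⟨hmaj0, hval0⟩ := integral_Ioi_inv_sq'' hc
  have hmaj := hmaj0.const_mul ((43 / 100 : ℝ) ^ 5 * (Real.sqrt 21)⁻¹)
  have hle : ∫ u in Ioi (21 : ℝ), srwHeatKernel u 0 ^ 5 ≤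
      ∫ u in Ioi (21 : ℝ), (43 / 100 : ℝ) ^ 5 * (Real.sqrt 21)⁻¹ * (u ^ 2)⁻¹ := by
    refine setIntegral_mono_on hint hmaj measurableSet_Ioi fun u hu => ?_
    have h := srwHeatKernel_zero_pow_five_le' (le_of_lt hu)
    calc srwHeatKernel u 0 ^ 5 ≤ (43 / 100) ^ 5 * ((u ^ 2)⁻¹ * (Real.sqrt 21)⁻¹) := h
      _ = (43 / 100 : ℝ) ^ 5 * (Real.sqrt 21)⁻¹ * (u ^ 2)⁻¹ := by ring
  rw [integral_const_mul, hval0] at hle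
  have hs : (4.5825 : ℝ) ≤ Real.sqrt 21 := Real.le_sqrt_of_sq_le (by norm_num)
  have hsinv : (Real.sqrt 21)⁻¹ ≤ 1 / 4.5825 := by
    rw [one_div]; exact (inv_le_inv₀ (by positivity) (by norm_num)).2 hs
  refine hle.trans ?_
  calc (43 / 100 : ℝ) ^ 5 * (Real.sqrt 21)⁻¹ * (21 : ℝ)⁻¹
      ≤ (43 / 100 : ℝ) ^ 5 * (1 / 4.5825) * (21 : ℝ)⁻¹ := by gcongr
    _ ≤ 153 / 1000000 := by norm_num

/-! ### The certificates: `R(6) ≤ 0.1862`, `5R(5) ≤ 1.1568` -/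

/-- **`6 R(6) ≤ 1.1171`**: `6·latticeGreen 0 ≤ Σ_{n<84} P(Sₙ=0) + 6∫_{14}^∞ r⁶ + r(14)⁶
≤ 1.1169010 + 0.43⁶(6/196 + 1/2744)`. [cite: SalmhoferSeiler1991, Prop. 4.2 (4) and p. 430 (`R(6) ≤ 0.1862`)] -/
theorem six_mul_latticeGreen_six_zero_le : 6 * latticeGreen (0 : Site 6) ≤ 11171 / 10000 := by
  have hIcc := (sum_range_prob_zero_mem_Icc (d := 6) (by norm_num) 84).1
  have h84 : ((84 : ℕ) : ℝ) / ((6 : ℕ) : ℝ) = 14 := by norm_num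
  rw [h84, sum_range_prob_six_eq] at hIcc
  have hP : ((probSixPartialQ 84 : ℚ) : ℝ) ≤ 11169010 / 10000000 := by
    have h := (Rat.cast_le (K := ℝ)).2 probSixPartialQ_84_le
    push_cast at h
    exact h
  have hT := integral_Ioi_srwHeatKernel_zero_pow_six_le
  have hr : srwHeatKernel 14 0 ^ 6 ≤ (43 / 100) ^ 6 * (((14 : ℝ) ^ 2)⁻¹ * (14 : ℝ)⁻¹) :=
    srwHeatKernel_zero_pow_six_le le_rfl
  push_cast at hIcc
  nlinarith

/-- **`1.1168 ≤ 6 R(6)`**: `Σ_{n<84} P(Sₙ=0) - r(14)⁶ ≤ 6·latticeGreen 0`. [cite: SalmhoferSeiler1991, p. 430 (`R(6) ≤ 0.1862`)] -/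
theorem le_six_mul_latticeGreen_six_zero : 11168 / 10000 ≤ 6 * latticeGreen (0 : Site 6) := by
  have hIcc := (sum_range_prob_zero_mem_Icc (d := 6) (by norm_num) 84).2
  have h84 : ((84 : ℕ) : ℝ) / ((6 : ℕ) : ℝ) = 14 := by norm_num
  rw [h84, sum_range_prob_six_eq] at hIcc
  have hP : (11169009 / 10000000 : ℝ) ≤ ((probSixPartialQ 84 : ℚ) : ℝ) := by
    have h := (Rat.cast_le (K := ℝ)).2 le_probSixPartialQ_84
    push_cast at h
    exact h
  have hr : srwHeatKernel 14 0 ^ 6 ≤ (43 / 100) ^ 6 * (((14 : ℝ) ^ 2)⁻¹ * (14 : ℝ)⁻¹) :=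
    srwHeatKernel_zero_pow_six_le le_rfl
  push_cast at hIcc
  nlinarith

/-- **Salmhofer–Seiler's `R(6) ≤ 0.1862`** (p. 430), kernel-certified (true value `0.18616`).
[cite: SalmhoferSeiler1991, p. 430] -/
theorem latticeGreen_six_zero_le : latticeGreen (0 : Site 6) ≤ 1862 / 10000 := by
  linarith [six_mul_latticeGreen_six_zero_le]

/-- `0.1861 ≤ R(6) ≤ 0.1862`. [cite: SalmhoferSeiler1991, p. 430] -/
theorem latticeGreen_six_zero_mem_Icc :
    1861 / 10000 ≤ latticeGreen (0 : Site 6) ∧ latticeGreen (0 : Site 6) ≤ 1862 / 10000 := by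
  constructor <;> linarith [six_mul_latticeGreen_six_zero_le, le_six_mul_latticeGreen_six_zero]

/-- **`5 R(5) ≤ 1.1568`** (`Σ_{n<105} P + 5∫_{21}^∞ r⁵ + r(21)⁵`; the companion file's `K = 42` bound is
`1.1816`; true value `1.15631`). [cite: SalmhoferSeiler1991, Prop. 4.2 (4) and p. 430 (`R(5) ≤ 0.2313`)] -/
theorem five_mul_latticeGreen_five_zero_le' : 5 * latticeGreen (0 : Site 5) ≤ 11568 / 10000 := by
  have hIcc := (sum_range_prob_zero_mem_Icc (d := 5) (by norm_num) 105).1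
  have h105 : ((105 : ℕ) : ℝ) / ((5 : ℕ) : ℝ) = 21 := by norm_num
  rw [h105, sum_range_prob_five_eq] at hIcc
  have hP : ((probFivePartialQ 105 : ℚ) : ℝ) ≤ 11559606 / 10000000 := by
    have h := (Rat.cast_le (K := ℝ)).2 probFivePartialQ_105_le
    push_cast at h
    exact h
  have hT := integral_Ioi_srwHeatKernel_zero_pow_five_le'
  have hr : srwHeatKernel 21 0 ^ 5 ≤ (43 / 100) ^ 5 * (((21 : ℝ) ^ 2)⁻¹ * (Real.sqrt 21)⁻¹) :=
    srwHeatKernel_zero_pow_five_le' le_rfl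
  have hs : (4.5825 : ℝ) ≤ Real.sqrt 21 := Real.le_sqrt_of_sq_le (by norm_num)
  have hsinv : (Real.sqrt 21)⁻¹ ≤ 1 / 4.5825 := by
    rw [one_div]; exact (inv_le_inv₀ (by positivity) (by norm_num)).2 hs
  have hr' : srwHeatKernel 21 0 ^ 5 ≤ (43 / 100) ^ 5 * (((21 : ℝ) ^ 2)⁻¹ * (1 / 4.5825)) :=
    hr.trans (by gcongr)
  push_cast at hIcc
  nlinarith

end Literature.Probability.LatticeModels

end
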